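import Literature.Probability.Percolation.PlateChartRoom
import Literature.Probability.Percolation.SiteInterfaceSeparation
import Literature.Probability.Percolation.TriPlateBlocking
import Literature.Probability.Percolation.TriAnnulusCrossing
import Literature.Probability.Percolation.TriAnnulusArms
import Literature.Probability.Percolation.OneArmLSW
import Literature.Probability.Percolation.HexPolygonSubarcs
import Literature.Probability.Percolation.ClosedPolygonArcs
import Literature.Topology.PlaneTopology.SeparatedCrossings
import HarnessLib

/-!
# A honeycomb loop arc between an open and a closed vertical plate crossing of `δ𝕋`

Topic: Probability / Percolation; proofs only.  The `𝕋`-side, deterministic extraction step of the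
transfer of crossing events through loop ensembles (F. Camia, C. M. Newman, Comm. Math. Phys. 268
(2006), §5, proof of Thm 3: between a blue and a yellow crossing of a quad runs a percolation
interface, which itself crosses the quad), for site percolation on the triangular lattice at mesh
`δ` read through a plane homeomorphism `Φ` (plate vocabulary of `PlateCrossingEvents.lean`:
`plateBox`, `triPlateV Φ δ x yin yout` = an open path drawn in `Φ(plateBox x yout)` from
`Φ{im ≤ -yin}` to `Φ{yin ≤ im}`):

* `norm_triMeshPoint_le_of_pathIn_of_not_mem_triAnnulusCrossing` — **window**: off the open
  annulus-crossing event `triAnnulusCrossing true δ 0 W₀ W₁`, the open cluster of a site drawn in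
  `B(0, W₀)` is drawn in `B̄(0, W₁)` (hence finite, `finite_pathIn_of_not_mem_triAnnulusCrossing`);
* `IsSiteInterfaceLoop.loopWind_eq_of_mem_triWalkTrace_of_forall_mem` / `…_not_mem` — the
  winding number of an interface polygon on the drawn trace of an open (resp. closed) walk equals
  its value at the sites of the walk (open–open and closed–closed edges miss the polygon);
* `exists_polyTrace_continuum_of_triPlateV` — **the interface crosses the plate (chart form)**:
  an open AND a closed vertical crossing of `Φ(plateBox x yout)` between the zones force an
  interface loop `w` (left sites in `B̄(0, W₁)`) whose polygon, pulled back by `Φ`, contains a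
  compact connected `C` inside `[-a, a] × [-d, d]` (`x + ν ≤ a`, `0 < d ≤ yin`, chart room
  `(ν, ρ)`, `δ ≤ ρ`) meeting both horizontal sides: the separating loop of
  `exists_isSiteInterfaceLoop_loopWind_eq` winds `m` about the open chain and `m - 1` about the
  closed one, winding numbers are constant on connected sets off the polygon
  (`loopWind_eq_of_mem_connectedComponentIn`), so continuum duality
  (`exists_crossing_continuum_of_separated`) applies;
* `exists_siteLoop_arc_of_triPlateV` — **the loop arc**: for a room `c > 0` and `δ ≤ δ₀(Φ, c)`,
  some interface loop with trace in `B(0, W₁ + 1)` has a based representative `β`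
  (`CurveClass.mk β = siteLoopCurve δ w'`) and a parameter interval `[s, t]` mapped into
  `Φ(plateBox (x + c/2) yin)` and meeting `Φ{im ≤ -(yin - c/2)}`, `Φ{yin - c/2 ≤ im}`: `Φ(C)` is
  covered by, and meets every piece of, a stretch `a ≤ j ≤ b` of pieces of a rotation
  `w' = w.rotateAt k` (`exists_rotateAt_Icc_of_isPreconnected`: non-adjacent pieces of a simple
  hexagonal polygon are disjoint), which is the parameter interval `[a/n, (b+1)/n]` of the
  uniformly parametrised closed polygon `closedCurve (loopPts δ w')`
  (`siteLoopCurve_eq_closedPolygon`, `closedCurve_apply_mem_iUnion_segment`,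
  `exists_closedCurve_apply_eq`); chart room turns "within `2δ` of `Φ(C)`" into plate bounds.

## References

* F. Camia, C. M. Newman, Comm. Math. Phys. 268 (2006), §5. [CamiaNewman2006]
* B. Bollobás, O. Riordan, *Percolation* (2006), Ch. 7 §7.2.3 and Lemma 4 p. 166. [BollobasRiordan2006]
-/

noncomputable section

namespace Literature.Probability.Percolation

open Literature.Probability.RandomPlanarGeometry
open Literature.Probability.LatticeModels
open Literature.Topology.PlaneTopology
open Filter Topology Set Metric Complex Function
open scoped unitInterval

/-! ### Window: no open arm means bounded open clusters -/

/-- **No open annulus crossing bounds the open clusters of the inner disc.**  If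
`ω ∉ triAnnulusCrossing true δ 0 W₀ W₁` and `u` is drawn in `B(0, W₀)`, every site joined to `u`
by an open path is drawn in `B̄(0, W₁)`. [cite: BollobasRiordan2006, Ch. 7 Lemma 4 (p. 166)] -/
theorem norm_triMeshPoint_le_of_pathIn_of_not_mem_triAnnulusCrossing {ω : SiteConfig (Site 2)}
    {δ W₀ W₁ : ℝ} (hwin : ω ∉ triAnnulusCrossing true δ 0 W₀ W₁) {u y : Site 2}
    (hu : ‖triMeshPoint δ u‖ < W₀) (h : PathIn triGraph ω u y) : ‖triMeshPoint δ y‖ ≤ W₁ := by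
  by_contra hlt
  push Not at hlt
  obtain ⟨W, hW⟩ := h.exists_walk
  exact hwin ⟨u, y, W, by simpa using hu, by simpa using hlt, fun v hv ↦ by simpa using hW v hv⟩

/-- **No open annulus crossing makes the open clusters of the inner disc finite** (`δ > 0`).
[cite: BollobasRiordan2006, Ch. 7 Lemma 4 (p. 166)] -/
theorem finite_pathIn_of_not_mem_triAnnulusCrossing {ω : SiteConfig (Site 2)} {δ W₀ W₁ : ℝ}
    (hδ : 0 < δ) (hwin : ω ∉ triAnnulusCrossing true δ 0 W₀ W₁) {u : Site 2}
    (hu : ‖triMeshPoint δ u‖ < W₀) : {y : Site 2 | PathIn triGraph ω u y}.Finite :=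
  (finite_setOf_dist_triMeshPoint_le hδ 0 W₁).subset fun y hy ↦ by
    simpa [dist_zero_right] using norm_triMeshPoint_le_of_pathIn_of_not_mem_triAnnulusCrossing hwin hu hy

/-! ### Winding numbers on the drawn traces of monochromatic walks -/

section Wind

variable {ω : SiteConfig (Site 2)} {f₀ : HexVertex} {w : hexGraph.Walk f₀ f₀}
  (hw : IsSiteInterfaceLoop ω w) {δ : ℝ} (hδ : 0 < δ)

include hw hδ

/-- **The winding number on the trace of an open walk** equals its (common) value at the sites of
the walk: every trace point lies on an open–open edge, which misses the polygon.
[cite: CamiaNewman2006, §4] -/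
theorem IsSiteInterfaceLoop.loopWind_eq_of_mem_triWalkTrace_of_forall_mem {u v : Site 2}
    {π : triGraph.Walk u v} (hπ : ∀ z ∈ π.support, z ∈ ω) {m : ℤ}
    (hm : ∀ a ∈ π.support, loopWind δ w (triMeshPoint δ a) = m) {p : ℂ} (hp : p ∈ triWalkTrace δ π) :
    loopWind δ w p = m := by
  have hlen : 0 < w.length := by have := hw.isCycle.three_le_length; omega
  obtain ⟨e, he, hpe⟩ := mem_triWalkTrace_iff.1 hp
  revert he hpe
  induction e using Sym2.ind with
  | h a b =>
    intro he hpe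
    rw [triEdgeSeg_mk] at hpe
    have ha := hπ a (π.fst_mem_support_of_mem_edges he)
    have hb := hπ b (π.snd_mem_support_of_mem_edges he)
    have hseg : segment ℝ (triMeshPoint δ a) (triMeshPoint δ b) ⊆ (polyTrace δ w)ᶜ := fun z hz hzT ↦
      Set.disjoint_left.1 (hw.segment_disjoint_polyTrace_of_mem hδ (Or.inr (π.adj_of_mem_edges he)) ha hb) hz hzT
    have key := loopWind_eq_of_mem_connectedComponentIn hlen
      ((convex_segment _ _).isPreconnected.subset_connectedComponentIn (left_mem_segment ℝ _ _) hseg hpe)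
    rw [← key, hm a (π.fst_mem_support_of_mem_edges he)]

/-- **The winding number on the trace of a closed walk** equals its value at the sites of the
walk (closed–closed edges miss the polygon). [cite: CamiaNewman2006, §4] -/
theorem IsSiteInterfaceLoop.loopWind_eq_of_mem_triWalkTrace_of_forall_not_mem {u v : Site 2}
    {π : triGraph.Walk u v} (hπ : ∀ z ∈ π.support, z ∉ ω) {m : ℤ}
    (hm : ∀ a ∈ π.support, loopWind δ w (triMeshPoint δ a) = m) {p : ℂ} (hp : p ∈ triWalkTrace δ π) :
    loopWind δ w p = m := by
  have hlen : 0 < w.length := by have := hw.isCycle.three_le_length; omega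
  obtain ⟨e, he, hpe⟩ := mem_triWalkTrace_iff.1 hp
  revert he hpe
  induction e using Sym2.ind with
  | h a b =>
    intro he hpe
    rw [triEdgeSeg_mk] at hpe
    have ha := hπ a (π.fst_mem_support_of_mem_edges he)
    have hb := hπ b (π.snd_mem_support_of_mem_edges he)
    have hseg : segment ℝ (triMeshPoint δ a) (triMeshPoint δ b) ⊆ (polyTrace δ w)ᶜ := fun z hz hzT ↦
      Set.disjoint_left.1 (hw.segment_disjoint_polyTrace_of_not_mem hδ (Or.inr (π.adj_of_mem_edges he)) ha hb)
        hz hzT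
    have key := loopWind_eq_of_mem_connectedComponentIn hlen
      ((convex_segment _ _).isPreconnected.subset_connectedComponentIn (left_mem_segment ℝ _ _) hseg hpe)
    rw [← key, hm a (π.fst_mem_support_of_mem_edges he)]

end Wind

/-! ### The interface between an open and a closed vertical plate crossing crosses the plate -/

/-- **The interface loop between an open and a closed vertical plate crossing crosses the plate
(chart form).**  See the module docstring. [cite: CamiaNewman2006, §5] -/
theorem exists_polyTrace_continuum_of_triPlateV (Φ : ℂ ≃ₜ ℂ) {ν ρ δ : ℝ}
    (hroom : ∀ z ∈ plateBox 2 2, ∀ p : ℂ, dist p (Φ z) ≤ ρ → dist (Φ.symm p) z ≤ ν)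
    (hδ : 0 < δ) (hδρ : δ ≤ ρ) {W₀ W₁ : ℝ} (hW : Φ '' plateBox 2 2 ⊆ ball (0 : ℂ) W₀)
    {x yin yout a d : ℝ} (hx2 : x ≤ 2) (hyout : yout ≤ 2) (ha : 0 < a) (hxa : x + ν ≤ a) (hd0 : 0 < d)
    (hdy : d ≤ yin) {ω : SiteConfig (Site 2)} (hwin : ω ∉ triAnnulusCrossing true δ 0 W₀ W₁)
    (hV : ω ∈ triPlateV Φ δ x yin yout) (hV' : ωᶜ ∈ triPlateV Φ δ x yin yout) :
    ∃ (F : HexVertex) (w : hexGraph.Walk F F) (hw : IsSiteInterfaceLoop ω w),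
      (∀ i < w.length, ‖triMeshPoint δ (hw.lv i)‖ ≤ W₁) ∧
      ∃ C ⊆ Φ.symm '' polyTrace δ w ∩ (Icc (-a) a ×ℂ Icc (-d) d), IsCompact C ∧ IsPreconnected C ∧
        (∃ z ∈ C, z.im = -d) ∧ ∃ z ∈ C, z.im = d := by
  classical
  obtain ⟨u₁, hu₁, v₁, hv₁, hconn₁⟩ := hV
  obtain ⟨u₂, hu₂, v₂, hv₂, hconn₂⟩ := hV'
  obtain ⟨π, hπ⟩ := (mem_siteConnIn_iff_pathIn.1 hconn₁).exists_walk
  obtain ⟨κ, hκ⟩ := (mem_siteConnIn_iff_pathIn.1 hconn₂).exists_walk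
  have hu₁im : (Φ.symm (triMeshPoint δ u₁)).im ≤ -yin := symm_mem_of_mem_image hu₁
  have hv₁im : yin ≤ (Φ.symm (triMeshPoint δ v₁)).im := symm_mem_of_mem_image hv₁
  have hu₂im : (Φ.symm (triMeshPoint δ u₂)).im ≤ -yin := symm_mem_of_mem_image hu₂
  have hv₂im : yin ≤ (Φ.symm (triMeshPoint δ v₂)).im := symm_mem_of_mem_image hv₂
  have hπnil : ¬ π.Nil := SimpleGraph.Walk.not_nil_of_ne (by intro h; rw [h] at hu₁im; linarith)
  have hκnil : ¬ κ.Nil := SimpleGraph.Walk.not_nil_of_ne (by intro h; rw [h] at hu₂im; linarith)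
  -- the open cluster of `u₁` is drawn in `B̄(0, W₁)`, hence finite
  have hu₁W : ‖triMeshPoint δ u₁‖ < W₀ := by
    have := hW (image_mono (plateBox_subset_two hx2 hyout) (hπ u₁ π.start_mem_support).1)
    rwa [mem_ball, dist_zero_right] at this
  have hbound : ∀ y, PathIn triGraph ω u₁ y → ‖triMeshPoint δ y‖ ≤ W₁ := fun y hy ↦
    norm_triMeshPoint_le_of_pathIn_of_not_mem_triAnnulusCrossing hwin hu₁W hy
  have hfin := finite_pathIn_of_not_mem_triAnnulusCrossing hδ hwin hu₁W
  -- the separating interface loop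
  obtain ⟨F, w, hw, hlv, hC, hD⟩ := exists_isSiteInterfaceLoop_loopWind_eq hδ hfin
    (hπ u₁ π.start_mem_support).2 (hκ u₂ κ.start_mem_support).2
  refine ⟨F, w, hw, fun i hi ↦ hbound _ (hlv i hi), ?_⟩
  have hlen : 0 < w.length := by have := hw.isCycle.three_le_length; omega
  set m : ℤ := loopWind δ w (triMeshPoint δ u₁) with hm
  have hwπ : ∀ a' ∈ π.support, loopWind δ w (triMeshPoint δ a') = m := fun a' ha' ↦
    hC a' (PathIn.of_walk (π.takeUntil a' ha') fun z hz ↦ (hπ z (π.support_takeUntil_subset_support ha' hz)).2)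
  have hwκ : ∀ b' ∈ κ.support, loopWind δ w (triMeshPoint δ b') = m - 1 := fun b' hb' ↦
    hD b' (PathIn.of_walk (κ.takeUntil b' hb') fun z hz ↦ (hκ z (κ.support_takeUntil_subset_support hb' hz)).2)
  have htrπ : ∀ p ∈ triWalkTrace δ π, loopWind δ w p = m := fun p hp ↦
    hw.loopWind_eq_of_mem_triWalkTrace_of_forall_mem hδ (fun z hz ↦ (hπ z hz).2) hwπ hp
  have htrκ : ∀ p ∈ triWalkTrace δ κ, loopWind δ w p = m - 1 := fun p hp ↦
    hw.loopWind_eq_of_mem_triWalkTrace_of_forall_not_mem hδ (fun z hz ↦ (hκ z hz).2) hwκ hp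
  -- the chart picture
  have hδ' : |δ| ≤ ρ := by rwa [abs_of_pos hδ]
  have hTc : IsClosed (Φ.symm '' polyTrace δ w) := Φ.symm.isClosedMap _ (isClosed_polyTrace δ w)
  have hPstrip : ∀ z ∈ Φ.symm '' triWalkTrace δ π, -a ≤ z.re ∧ z.re ≤ a := by
    rintro _ ⟨p, hp, rfl⟩
    have h := symm_mem_plateBox_of_mem_triWalkTrace Φ hroom hδ' (plateBox_subset_two hx2 hyout)
      (fun z hz ↦ (hπ z hz).1) hp
    rw [mem_plateBox_iff_abs] at h
    constructor <;> linarith [(abs_le.1 h.1).1, (abs_le.1 h.1).2]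
  have hQstrip : ∀ z ∈ Φ.symm '' triWalkTrace δ κ, -a ≤ z.re ∧ z.re ≤ a := by
    rintro _ ⟨p, hp, rfl⟩
    have h := symm_mem_plateBox_of_mem_triWalkTrace Φ hroom hδ' (plateBox_subset_two hx2 hyout)
      (fun z hz ↦ (hκ z hz).1) hp
    rw [mem_plateBox_iff_abs] at h
    constructor <;> linarith [(abs_le.1 h.1).1, (abs_le.1 h.1).2]
  have hsep : ∀ S : Set ℂ, IsPreconnected S → Disjoint S (Φ.symm '' polyTrace δ w) →
      (S ∩ Φ.symm '' triWalkTrace δ π).Nonempty → (S ∩ Φ.symm '' triWalkTrace δ κ).Nonempty → False := by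
    rintro S hS hST ⟨_, hp₁S, p₁, hp₁, rfl⟩ ⟨_, hq₁S, q₁, hq₁, rfl⟩
    have hS' : IsPreconnected (Φ '' S) := hS.image _ Φ.continuous.continuousOn
    have hS'T : Φ '' S ⊆ (polyTrace δ w)ᶜ := by
      rintro _ ⟨z, hz, rfl⟩ hzT
      exact Set.disjoint_left.1 hST hz ⟨Φ z, hzT, Φ.symm_apply_apply z⟩
    have key := loopWind_eq_of_mem_connectedComponentIn hlen
      (hS'.subset_connectedComponentIn (mem_image_of_mem Φ hp₁S) hS'T (mem_image_of_mem Φ hq₁S))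
    rw [Homeomorph.apply_symm_apply, Homeomorph.apply_symm_apply, htrπ p₁ hp₁, htrκ q₁ hq₁] at key
    omega
  obtain ⟨C, hCsub, hCc, hCp, hCbot, hCtop⟩ := exists_crossing_continuum_of_separated
    (a := -a) (b := a) (c := -d) (d := d) (by linarith) (by linarith) hTc
    ((isCompact_triWalkTrace δ π).image Φ.symm.continuous)
    ((isPreconnected_triWalkTrace δ π).image _ Φ.symm.continuous.continuousOn) hPstrip
    ⟨_, mem_image_of_mem _ (triMeshPoint_mem_triWalkTrace hπnil π.start_mem_support), by linarith⟩
    ⟨_, mem_image_of_mem _ (triMeshPoint_mem_triWalkTrace hπnil π.end_mem_support), by linarith⟩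
    ((isCompact_triWalkTrace δ κ).image Φ.symm.continuous)
    ((isPreconnected_triWalkTrace δ κ).image _ Φ.symm.continuous.continuousOn) hQstrip
    ⟨_, mem_image_of_mem _ (triMeshPoint_mem_triWalkTrace hκnil κ.start_mem_support), by linarith⟩
    ⟨_, mem_image_of_mem _ (triMeshPoint_mem_triWalkTrace hκnil κ.end_mem_support), by linarith⟩
    hsep
  exact ⟨C, hCsub, hCc, hCp, hCbot, hCtop⟩

/-! ### From the crossing piece to the loop arc -/

/-- The trace of a rotation of a closed walk is the trace of the walk (same darts). [folklore] -/
theorem polyTrace_rotateAt_eq (δ : ℝ) {f₀ : HexVertex} {w : hexGraph.Walk f₀ f₀} {k : ℕ} (hk : k ≤ w.length) :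
    polyTrace δ (w.rotateAt k) = polyTrace δ w := by
  ext z
  simp only [mem_polyTrace_iff_exists_dart, SimpleGraph.Walk.darts_rotateAt w hk, List.mem_rotate]

/-- **The trace of an interface loop with left sites in `B̄(0, W)` lies in `B̄(0, W + δ)`**
(every point of a dart piece is within `δ` of the left site of the dart,
`polyPiece_subset_closedBall`). [cite: CamiaNewman2006, §4] -/
theorem IsSiteInterfaceLoop.norm_le_of_mem_polyTrace {ω : SiteConfig (Site 2)} {f₀ : HexVertex}
    {w : hexGraph.Walk f₀ f₀} (hw : IsSiteInterfaceLoop ω w) {δ W : ℝ} (hδ : 0 ≤ δ)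
    (hlv : ∀ i < w.length, ‖triMeshPoint δ (hw.lv i)‖ ≤ W) {z : ℂ} (hz : z ∈ polyTrace δ w) :
    ‖z‖ ≤ W + δ := by
  obtain ⟨i, hi, hzi⟩ := mem_polyTrace_iff.1 hz
  have h1 : dist z (hw.leftPt δ i) ≤ δ := mem_closedBall.1 (hw.polyPiece_subset_closedBall hδ hi hzi)
  have h2 := hlv i hi
  rw [IsSiteInterfaceLoop.leftPt] at h1
  have := norm_le_norm_add_norm_sub' z (triMeshPoint δ (hw.lv i))
  rw [← dist_eq_norm] at this
  linarith

/-- **A honeycomb loop arc between an open and a closed vertical plate crossing.**  See the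
module docstring. [cite: CamiaNewman2006, §5] -/
theorem exists_siteLoop_arc_of_triPlateV :
    ∀ (Φ : ℂ ≃ₜ ℂ) (c : ℝ), 0 < c → ∃ δ₀ : ℝ, 0 < δ₀ ∧ ∀ δ : ℝ, 0 < δ → δ ≤ δ₀ →
    ∀ (W₀ W₁ : ℝ), Φ '' plateBox 2 2 ⊆ ball (0 : ℂ) W₀ → W₀ < W₁ →
    ∀ (x yin yout : ℝ), c ≤ x → x + c ≤ 2 → 2 * c ≤ yin → yin ≤ yout → yout ≤ 2 →
    ∀ ω : SiteConfig (Site 2),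
      (ω ∉ triAnnulusCrossing true δ 0 W₀ W₁ ∧ ω ∉ triAnnulusCrossing false δ 0 W₀ W₁) →
      ω ∈ triPlateV Φ δ x yin yout → ωᶜ ∈ triPlateV Φ δ x yin yout →
      ∃ (f : HexVertex) (w : hexGraph.Walk f f), IsSiteInterfaceLoop ω w ∧
        (siteLoopCurve δ w).range ⊆ ball (0 : ℂ) (W₁ + 1) ∧
        ∃ (β : Curve ℂ) (s t : I), CurveClass.mk β = siteLoopCurve δ w ∧ s ≤ t ∧
          (∀ u ∈ Icc s t, β u ∈ Φ '' plateBox (x + c / 2) yin) ∧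
          (∃ u ∈ Icc s t, β u ∈ Φ '' {z : ℂ | z.im ≤ -(yin - c / 2)}) ∧
          (∃ u ∈ Icc s t, β u ∈ Φ '' {z : ℂ | yin - c / 2 ≤ z.im}) := by
  intro Φ c hc
  have hν : 0 < c / 16 := by positivity
  obtain ⟨ρ, hρ, hρ1, hroom⟩ := exists_chart_room_symm' Φ hν
  refine ⟨ρ / 2, by positivity, fun δ hδ hδρ ↦ ?_⟩
  intro W₀ W₁ hW hW₀₁ x yin yout hx hx2 hyin hyio hyout ω hwin hV hV'
  have hδρ' : δ ≤ ρ := by linarith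
  have h2δρ : 2 * δ ≤ ρ := by linarith
  ------------------------------------------------------------------
  -- Step 1: the separating loop and its crossing piece `C` in the chart rectangle
  ------------------------------------------------------------------
  obtain ⟨F, w, hw, hlvW, C, hCsub, hCc, hCp, ⟨zb, hzb, hzbim⟩, ⟨zt, hzt, hztim⟩⟩ :=
    exists_polyTrace_continuum_of_triPlateV Φ hroom hδ hδρ' hW (a := x + c / 4) (d := yin - c / 4)
      (by linarith) hyout (by linarith) (by linarith) (by linarith) (by linarith) hwin.1 hV hV'
  have hlen : 0 < w.length := by have := hw.isCycle.three_le_length; omega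
  have hCbox : ∀ z ∈ C, |z.re| ≤ x + c / 4 ∧ |z.im| ≤ yin - c / 4 := fun z hz ↦ by
    have h := (hCsub hz).2
    rw [mem_reProdIm, mem_Icc, mem_Icc] at h
    exact ⟨abs_le.2 ⟨h.1.1, h.1.2⟩, abs_le.2 ⟨h.2.1, h.2.2⟩⟩
  have hC2 : ∀ z ∈ C, z ∈ plateBox 2 2 := fun z hz ↦ by
    rw [mem_plateBox_iff_abs]; constructor <;> linarith [(hCbox z hz).1, (hCbox z hz).2]
  ------------------------------------------------------------------
  -- Step 2: the stretch of pieces of a rotation of `w` covering `Φ(C)`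
  ------------------------------------------------------------------
  have hC'p : IsPreconnected (Φ '' C) := hCp.image _ Φ.continuous.continuousOn
  have hC'sub : Φ '' C ⊆ polyTrace δ w := by
    rintro _ ⟨z, hz, rfl⟩
    obtain ⟨⟨p, hp, hpz⟩, -⟩ := hCsub hz
    rw [← hpz, Homeomorph.apply_symm_apply]; exact hp
  obtain ⟨k, hk0, hk, a, b, hab, hb, hcov, hmeet⟩ :=
    exists_rotateAt_Icc_of_isPreconnected hw.isCycle hδ.ne' hC'p hC'sub ⟨Φ zb, mem_image_of_mem _ hzb⟩
  set w' := w.rotateAt k with hw'def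
  have hw' : IsSiteInterfaceLoop ω w' := hw.rotateAt hk0 hk
  have hlen' : w'.length = w.length := SimpleGraph.Walk.length_rotateAt w hk
  have hn' : 0 < w'.length := by rw [hlen']; exact hlen
  have hb' : b < w'.length := by rw [hlen']; exact hb
  -- the based representative and the parameter interval
  have hpts : loopPts δ w' ≠ [] := by
    rw [← List.length_pos_iff, length_loopPts]; exact hn'
  have hptslen : (loopPts δ w').length = w'.length := length_loopPts δ w'
  have hnr : (0 : ℝ) < w'.length := by exact_mod_cast hn'
  set β : Curve ℂ := closedCurve (loopPts δ w') with hβdef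
  have hβ : CurveClass.mk β = siteLoopCurve δ w' := by
    rw [siteLoopCurve_eq_closedPolygon δ w' hn', closedPolygon_eq_mk_closedCurve]
  have hs01 : 0 ≤ (a : ℝ) / w'.length ∧ (a : ℝ) / w'.length ≤ 1 := by
    refine ⟨by positivity, ?_⟩
    rw [div_le_one hnr]; exact_mod_cast (hab.trans hb'.le)
  have ht01 : 0 ≤ ((b : ℝ) + 1) / w'.length ∧ ((b : ℝ) + 1) / w'.length ≤ 1 := by
    refine ⟨by positivity, ?_⟩
    rw [div_le_one hnr]; exact_mod_cast hb'
  set s : I := ⟨(a : ℝ) / w'.length, hs01.1, hs01.2⟩ with hsdef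
  set t : I := ⟨((b : ℝ) + 1) / w'.length, ht01.1, ht01.2⟩ with htdef
  -- on `[s, t]` the polygon is on a piece of the stretch
  have hpiece : ∀ u ∈ Icc s t, ∃ j, a ≤ j ∧ j ≤ b ∧ β u ∈ polyPiece δ w' j := by
    intro u hu
    have h1 : (a : ℝ) ≤ (loopPts δ w').length * u := by
      have : (a : ℝ) / w'.length ≤ u := hu.1
      rw [hptslen]; rwa [div_le_iff₀ hnr, mul_comm] at this
    have h2 : ((loopPts δ w').length : ℝ) * u ≤ b + 1 := by
      have : (u : ℝ) ≤ ((b : ℝ) + 1) / w'.length := hu.2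
      rw [hptslen]; rwa [le_div_iff₀ hnr, mul_comm] at this
    obtain ⟨j, haj, hjb, hmem⟩ := closedCurve_apply_mem_iUnion_segment hpts hab (by rw [hptslen]; exact hb') h1 h2
    refine ⟨j, haj, hjb, ?_⟩
    rw [← segment_loopPts_eq_polyPiece δ w' hn' (hjb.trans_lt hb')]
    exact hmem
  -- conversely every point of a piece of the stretch is `β u` for some `u ∈ [s, t]`
  have htime : ∀ {j : ℕ}, a ≤ j → j ≤ b → ∀ {p : ℂ}, p ∈ polyPiece δ w' j → ∃ u ∈ Icc s t, β u = p := by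
    intro j haj hjb p hp
    have hj : j < w'.length := hjb.trans_lt hb'
    rw [← segment_loopPts_eq_polyPiece δ w' hn' hj] at hp
    obtain ⟨u, h1, h2, hu⟩ := exists_closedCurve_apply_eq hpts (by rw [hptslen]; exact hj) hp
    rw [hptslen] at h1 h2
    refine ⟨u, ⟨?_, ?_⟩, hu⟩
    · change (a : ℝ) / w'.length ≤ u
      rw [div_le_iff₀ hnr, mul_comm]
      exact le_trans (by exact_mod_cast haj) h1
    · change (u : ℝ) ≤ ((b : ℝ) + 1) / w'.length
      rw [le_div_iff₀ hnr, mul_comm]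
      exact h2.trans (by exact_mod_cast Nat.succ_le_succ hjb)
  ------------------------------------------------------------------
  -- Step 3: conclusion
  ------------------------------------------------------------------
  refine ⟨_, w', hw', ?_, β, s, t, hβ, ?_, ?_, ?_, ?_⟩
  · -- the window: left sites in `B̄(0, W₁)`, trace within `δ` of them
    have hrg : (siteLoopCurve δ w').range = polyTrace δ w := by
      rw [siteLoopCurve, CurveClass.range_mk, hw'def, ← polyTrace_rotateAt_eq δ hk]
      exact range_toCurve_eq_polyTrace hn'
    intro z hz
    rw [hrg] at hz
    rw [mem_ball, dist_zero_right]
    have := hw.norm_le_of_mem_polyTrace hδ.le hlvW hz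
    linarith
  · change (a : ℝ) / w'.length ≤ ((b : ℝ) + 1) / w'.length
    exact div_le_div_of_nonneg_right (by exact_mod_cast Nat.le_succ_of_le hab) hnr.le
  · -- the band
    intro u hu
    obtain ⟨j, haj, hjb, hju⟩ := hpiece u hu
    obtain ⟨_, ⟨z₀, hz₀, rfl⟩, hz₀j⟩ := hmeet j ⟨haj, hjb⟩
    have hj : j < w'.length := hjb.trans_lt hb'
    have hdist : dist (β u) (Φ z₀) ≤ ρ := by
      have h1 := mem_closedBall.1 (hw'.polyPiece_subset_closedBall hδ.le hj hju)
      have h2 := mem_closedBall.1 (hw'.polyPiece_subset_closedBall hδ.le hj hz₀j)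
      linarith [dist_triangle_right (β u) (Φ z₀) (hw'.leftPt δ j)]
    have hnear := chart_coords_near hroom (hC2 z₀ hz₀) hdist
    have hbz := hCbox z₀ hz₀
    refine mem_image_of_symm_mem ?_
    rw [mem_plateBox_iff_abs]
    constructor
    · have := abs_sub_abs_le_abs_sub (Φ.symm (β u)).re z₀.re; linarith [hnear.1, hbz.1]
    · have := abs_sub_abs_le_abs_sub (Φ.symm (β u)).im z₀.im; linarith [hnear.2, hbz.2]
  · -- the bottom zone: the point of `C` on `im = -(yin - c/4)`
    have hzb' : Φ zb ∈ Φ '' C := mem_image_of_mem _ hzb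
    obtain ⟨j, hj, hzbj⟩ := mem_iUnion₂.1 (hcov hzb')
    obtain ⟨u, hu, hβu⟩ := htime hj.1 hj.2 hzbj
    refine ⟨u, hu, mem_image_of_symm_mem ?_⟩
    show (Φ.symm (β u)).im ≤ -(yin - c / 2)
    rw [hβu, Homeomorph.symm_apply_apply, hzbim]; linarith
  · -- the top zone
    have hzt' : Φ zt ∈ Φ '' C := mem_image_of_mem _ hzt
    obtain ⟨j, hj, hztj⟩ := mem_iUnion₂.1 (hcov hzt')
    obtain ⟨u, hu, hβu⟩ := htime hj.1 hj.2 hztj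
    refine ⟨u, hu, mem_image_of_symm_mem ?_⟩
    show yin - c / 2 ≤ (Φ.symm (β u)).im
    rw [hβu, Homeomorph.symm_apply_apply, hztim]; linarith

end Literature.Probability.Percolation

end
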